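import Summits.Ventures.HSemireg.WedgeHankelKernelColumnSpace

/-!
# Venture HSemireg — THE HANKEL RANK PROFILE IS 1-LIPSCHITZ: for every coefficient sequence `q` and `k + 1 ≤ N`, **`rank H_{k+1}(q) ≤ rank H_k(q) + 1` and
# `rank H_k(q) ≤ rank H_{k+1}(q) + 1`** — both catalecticants contain the common block `(q_{i+s})_{i ≤ k, s ≤ N−k−1}` (all columns of `H_k` but the last, all rows of `H_{k+1}` but the last),
# and one extra column or row changes the rank by at most one; hence `|rank H_j(q) − rank H_k(q)| ≤ |j − k|` along the whole profile `k = 0, …, N` (every field)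

HONEST FRAMING. Part of the Lean index of the computation cell `pub-hsemireg` (seat p10 gen 25, Sunday typer «UNIFORM-IN-n»).
LINEAR ALGEBRA OF HANKEL (catalecticant) MATRICES over a field ONLY: no variety, no cohomology theory, no sheaf, no Ext group and no semiregularity map is constructed here; nothing here says
that HC / HC_CM / HC_AV holds; no Literature fact is declared or used.  Custodian versions as in `WedgeHankelSiegelIdeal` (1/3); the dictionary (`rank H_k(q)` = the Hankel factor of THEOREM H,
`dim V(univ, w_N q, k) = C(N,k) · rank H_k(q)`) is QUOTED, never asserted.

WHAT IS IN THE TREE.  th-7's `hankel1`; D11 `rank_hankel1_symm` (`rank H_k = rank H_{N−k}`, the profile is a palindrome); the regime laws (`rank H_k ≤ min(k+1, N+1−k)`, the secant / divisor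
ranks, Sylvester's window H3); Mathlib `Matrix.rank_submatrix_le`, `Matrix.rank_transpose`, `Matrix.rank_eq_finrank_span_cols`.
THIS FILE (namespace `Summit.Ventures.HSemireg.Wedge.HankelOuter` continued; imports M14 for the environment only):
* §455 generic: **`rank_le_rank_submatrix_add_one`** (dropping all columns outside the range of `f`, which misses at most ONE column `j₀`, loses at most `1` from the rank),
  `rank_le_rank_submatrix_rows_add_one` (the same for rows, by transposition).
* §456 **`hankel1_succ_submatrix_castSucc`** (the common block: `H_{k+1}` minus its last row = `H_k` minus its last column), **`rank_hankel1_succ_le_add_one`** (`rank H_{k+1} ≤ rank H_k + 1`),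
  **`rank_hankel1_le_succ_add_one`** (`rank H_k ≤ rank H_{k+1} + 1`), and along the profile **`rank_hankel1_le_add_sub`** / **`rank_hankel1_le_add_sub'`** (`k ≤ j ≤ N`:
  `rank H_j ≤ rank H_k + (j − k)` and `rank H_k ≤ rank H_j + (j − k)`).
READING: with D11's palindrome and the plateau laws, the rank row of THEOREM H is a symmetric 1-Lipschitz profile — the shape the census tables of FORMULA-N display; the fourth regime
(H3's Sylvester window) is where the profile is not determined by the divisor, but it is still 1-Lipschitz.  Nothing Ext-side.  New names only.
-/

open Module

namespace Summit.Ventures.HSemireg.Wedge.HankelOuter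

open Summit.Ventures.HSemireg.Wedge Summit.Ventures.HSemireg.Wedge.Kunneth Summit.Ventures.HSemireg.Wedge.Hankel
  Summit.Ventures.HSemireg.Wedge.BasisFree Summit.Ventures.HSemireg.Wedge.HankelSiegel Summit.Ventures.HSemireg.Wedge.HankelSiegelIdeal
  Summit.Ventures.HSemireg.Wedge.KunnethKernel Summit.Ventures.HSemireg.Wedge.HankelFrameChange Summit.Ventures.HSemireg.Wedge.KernelDuality

variable (K : Type*) [Field K] {N : ℕ}

/-! ## §455. One extra column or row changes the rank by at most one -/

/-- **keeping the columns in the range of `f`, which misses at most the column `j₀`, loses at most `1` from the rank: `rank A ≤ rank (A.submatrix id f) + 1`.** -/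
theorem rank_le_rank_submatrix_add_one {m n n₀ : Type} [Fintype m] [Fintype n] [Fintype n₀] (A : Matrix m n K) (f : n₀ → n) (j₀ : n)
    (hf : ∀ j, j ≠ j₀ → ∃ i, f i = j) : A.rank ≤ (A.submatrix id f).rank + 1 := by
  rw [Matrix.rank_eq_finrank_span_cols, Matrix.rank_eq_finrank_span_cols]
  have hle : Submodule.span K (Set.range A.col) ≤ Submodule.span K (Set.range (A.submatrix id f).col) ⊔ K ∙ A.col j₀ := by
    rw [Submodule.span_le]
    rintro _ ⟨j, rfl⟩
    by_cases hj : j = j₀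
    · subst hj
      exact Submodule.mem_sup_right (Submodule.mem_span_singleton_self _)
    · obtain ⟨i, rfl⟩ := hf j hj
      refine Submodule.mem_sup_left (Submodule.subset_span ⟨i, ?_⟩)
      funext a
      rw [Matrix.col_apply, Matrix.col_apply, Matrix.submatrix_apply, id]
  refine (Submodule.finrank_mono hle).trans ((Submodule.finrank_add_le_finrank_add_finrank _ _).trans ?_)
  have h1 := finrank_span_le_card (R := K) ({A.col j₀} : Set (m → K))
  rw [Set.toFinset_singleton, Finset.card_singleton] at h1
  omega

/-- **the same for rows: keeping the rows in the range of `g`, which misses at most the row `i₀`, loses at most `1` from the rank** (transpose). -/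
theorem rank_le_rank_submatrix_rows_add_one {m n m₀ : Type} [Fintype m] [Fintype n] [Fintype m₀] (A : Matrix m n K) (g : m₀ → m) (i₀ : m)
    (hg : ∀ i, i ≠ i₀ → ∃ l, g l = i) : A.rank ≤ (A.submatrix g id).rank + 1 := by
  have h := rank_le_rank_submatrix_add_one K A.transpose g i₀ hg
  rwa [Matrix.rank_transpose, ← Matrix.transpose_submatrix, Matrix.rank_transpose] at h

/-! ## §456. The rank profile of one class is 1-Lipschitz -/

omit [Field K] in
/-- **THE COMMON BLOCK: `H_{k+1}(q)` without its last row IS `H_k(q)` without its last column** — both are `(q_{i+s})_{i ≤ k, s ≤ N−k−1}`. -/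
theorem hankel1_succ_submatrix_castSucc (k : ℕ) (q : ℕ → K) :
    (hankel1 K N (k + 1) q).submatrix (Fin.castSucc : Fin (k + 1) → Fin (k + 1 + 1)) id
      = (hankel1 K N k q).submatrix id (fun s : Fin (N + 1 - (k + 1)) => (⟨(s : ℕ), by omega⟩ : Fin (N + 1 - k))) := by
  ext i s
  simp only [Matrix.submatrix_apply, id, hankel1, Matrix.of_apply, Fin.val_castSucc]

/-- **`rank H_{k+1}(q) ≤ rank H_k(q) + 1`** (`k + 1 ≤ N`): dropping the last row of `H_{k+1}` gives a block of `H_k`. -/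
theorem rank_hankel1_succ_le_add_one {k : ℕ} (hk : k + 1 ≤ N) (q : ℕ → K) :
    (hankel1 K N (k + 1) q).rank ≤ (hankel1 K N k q).rank + 1 := by
  have _ := hk
  have h1 := rank_le_rank_submatrix_rows_add_one K (hankel1 K N (k + 1) q) (Fin.castSucc : Fin (k + 1) → Fin (k + 1 + 1)) (Fin.last (k + 1))
    (fun i hi => Fin.exists_castSucc_eq.mpr hi)
  rw [hankel1_succ_submatrix_castSucc] at h1
  exact h1.trans (Nat.add_le_add_right (Matrix.rank_submatrix_le _ _ _) 1)

/-- **`rank H_k(q) ≤ rank H_{k+1}(q) + 1`** (`k + 1 ≤ N`): dropping the last column of `H_k` gives a block of `H_{k+1}`. -/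
theorem rank_hankel1_le_succ_add_one {k : ℕ} (hk : k + 1 ≤ N) (q : ℕ → K) :
    (hankel1 K N k q).rank ≤ (hankel1 K N (k + 1) q).rank + 1 := by
  have h1 := rank_le_rank_submatrix_add_one K (hankel1 K N k q) (fun s : Fin (N + 1 - (k + 1)) => (⟨(s : ℕ), by omega⟩ : Fin (N + 1 - k))) ⟨N - k, by omega⟩
    (fun j hj => ⟨⟨(j : ℕ), by have := j.2; have : (j : ℕ) ≠ N - k := fun e => hj (Fin.ext e); omega⟩, Fin.ext rfl⟩)
  rw [← hankel1_succ_submatrix_castSucc] at h1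
  exact h1.trans (Nat.add_le_add_right (Matrix.rank_submatrix_le _ _ _) 1)

/-- **ALONG THE PROFILE: `rank H_j(q) ≤ rank H_k(q) + (j − k)` for `k ≤ j ≤ N`.** -/
theorem rank_hankel1_le_add_sub {k j : ℕ} (hkj : k ≤ j) (hj : j ≤ N) (q : ℕ → K) :
    (hankel1 K N j q).rank ≤ (hankel1 K N k q).rank + (j - k) := by
  obtain ⟨d, rfl⟩ := Nat.exists_eq_add_of_le hkj
  induction d with
  | zero => simp
  | succ d ih =>
    have h1 := rank_hankel1_succ_le_add_one K (k := k + d) (by omega) q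
    have h2 := ih (by omega) (by omega)
    rw [show k + (d + 1) = k + d + 1 by omega]
    omega

/-- **… and `rank H_k(q) ≤ rank H_j(q) + (j − k)` for `k ≤ j ≤ N`: the profile `k ↦ rank H_k(q)` is 1-Lipschitz.** -/
theorem rank_hankel1_le_add_sub' {k j : ℕ} (hkj : k ≤ j) (hj : j ≤ N) (q : ℕ → K) :
    (hankel1 K N k q).rank ≤ (hankel1 K N j q).rank + (j - k) := by
  obtain ⟨d, rfl⟩ := Nat.exists_eq_add_of_le hkj
  induction d with
  | zero => simp
  | succ d ih =>
    have h1 := rank_hankel1_le_succ_add_one K (k := k + d) (by omega) q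
    have h2 := ih (by omega) (by omega)
    rw [show k + (d + 1) = k + d + 1 by omega]
    omega

end Summit.Ventures.HSemireg.Wedge.HankelOuter
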